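import Summits.ResolutionOfSingularities.ResolutionOfSingularities.Theorems.EquisingularLiftEquisingularLiftNatClusterLiftOnePoint
import Mathlib
import HarnessLib

/-!
# [OURS · L1 W4.5(b)] T-CLUSTER-LIFT part 3 — TWO FAT POINTS ARE NOT SUPERABUNDANT in degree `d ≥ m₁ + m₂ − 1`: the joint
# Taylor-jet map at two distinct points of a chart is onto on the degree-`d` forms; hence the TWO-POINT lift of orders `≥ m₁, m₂`
# along any two sections exists (crux `EquisingularLiftNat` = stmt-ResolutionOfSingularities-20038, line `sections`; rung v7′ TC⁺⁺)

NOT a statement of any manuscript. Helper file of the chain res-L1-w45b (cell `res-hironaka`, LADDER-RESOLUTION rung L, slot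
W4.5(b)); OURS; AI-written, weaker than expert review; `--supports stmt-ResolutionOfSingularities-20038 --as helper` by
res-L1-w45b-stub-3 (object T-CLUSTER-LIFT, part 3). No `sorry`; standard axioms.

WHAT. Part 1 (…NatClusterLift) lifts a degree-`d` form through a cluster of sections under the downstairs INDEPENDENCE hypothesis
`hind`; part 2 (…NatClusterLiftOnePoint) discharges `hind` for one point (`m ≤ d + 1`). This file discharges it for TWO DISTINCT
POINTS of a common chart when `m₁ + m₂ ≤ d + 1` — res-L1-w45b-lead-2 DESIGN v6 (TC⁺) 08:21:51Z singled out «two singular points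
sectioned in the same carrier curve» as the place «where liftability becomes an incidence condition»; the theorem below says the
incidence condition is EMPTY for two points as long as `m₁ + m₂ ≤ d + 1` (for a REDUCED plane curve `Z = V(g)` of degree `d` and
two of its points this always holds — Bézout with the line `L` through them if `L ⊄ Z`, and `Z = L ∪ Z′`, `L ⊄ Z′`,
`m₁ + m₂ ≤ 2 + (d − 1)` otherwise; by hand, not used here), so the first genuinely superabundant clusters have ≥ 3 points (three
collinear double points on a quartic; F₇⁻):

* §1 jets ↔ classes: `sub_mem_pow_span_X_sub_C_of_forall_coeff_eq` / `coeff_eq_of_sub_mem_pow_span_X_sub_C` (same jets of order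
  `< m` at `a` ⟺ congruent mod `𝔪_a^m`, from part 1's dictionary), `coeff_aeval_X_add_C_jetPoly` (the polynomial
  `Σ_{β ∈ S} v_β (X − a)^β` has jet `v` on `S`), `exists_isHomogeneous_mk_dehomogenize_eq` (part 2 in quotient currency: for
  `m ≤ d + 1` every class mod `𝔪_a^m` is the class of `h(T_i := 1)` for a degree-`d` form `h`);
* §2 `isUnit_mk_pow_of_sub_one_mem` (`x ≡ 1 mod I` ⇒ `x` is a unit mod `I^m`), `exists_isHomogeneous_mk_eq_and_mk_eq_zero` (a
  degree-`d` form with PRESCRIBED class mod `𝔪_a^{m₁}` and class `0` mod `𝔪_b^{m₂}`: `g = ℓ_b^{m₂} · h` with the separating linear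
  form `ℓ_b = (a_j − b_j)⁻¹ (T_j − b_j T_i)`, `ℓ_b(T_i := 1) ∈ 𝔪_b`, `≡ 1 mod 𝔪_a`, hence a unit mod `𝔪_a^{m₁}`, and `h` of degree
  `d − m₂ ≥ m₁ − 1` from part 2), **`exists_isHomogeneous_mk_dehomogenize_eq_twoPoints`** (both classes prescribed: add the two);
* §3 **`exists_isHomogeneous_forall_coeff_eq_twoPoints`** — part 1's `hind` for the two-point cluster (jet currency) — and the
  headline **`exists_isHomogeneous_lift_dehomogenize_mem_pow_twoPoints`**: `π : O ↠ k` onto a FIELD, `ker π ≤ jacobson ⊥`; two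
  `O`-points `a, b` on the chart `i` with DISTINCT reductions; `m₁ + m₂ ≤ d + 1`; a degree-`d` form `g` over `k` of order `≥ m₁` at
  `ā` and `≥ m₂` at `b̄` ⇒ a degree-`d` form `G` over `O` with `map π G = g`, of order `≥ m₁` along the section `a` AND `≥ m₂` along
  the section `b` (part 1 headline with `ι = Fin 2`).

References: parts 1–2; Mathlib `IsNilpotent.isUnit_add_one`, `Ideal.Quotient.*`. res-L1-w45b-lead-2 DESIGN v6 (TC⁺) / LEAD-MEMO-5 §A;
res-L1-w45b-tri-1 XDERIVE-M1-DELTAJUNCTION Y3(ii) (OURS planning texts, index only).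
-/

set_option linter.dupNamespace false -- mandated namespace `Summit.<Summit>.<Problem>` of this single-conjunct summit

noncomputable section

open MvPolynomial Literature.AlgebraicGeometry.Resolution

namespace Summit.ResolutionOfSingularities.ResolutionOfSingularities.Theorems.EquisingularLiftNat.ClusterLift

/-! ## §1 Jets and classes modulo `𝔪_a^m` -/

section JetClass

variable {R : Type*} [CommRing R] {τ : Type*}

/-- Polynomials with the same jet of order `< m` at `a` are congruent modulo `𝔪_a^m`. [folklore] -/
theorem sub_mem_pow_span_X_sub_C_of_forall_coeff_eq (a : τ → R) (m : ℕ) {f f' : MvPolynomial τ R}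
    (h : ∀ α : τ →₀ ℕ, α.degree < m →
      coeff α (aeval (fun l : τ => (X l : MvPolynomial τ R) + C (a l)) f) =
        coeff α (aeval (fun l : τ => (X l : MvPolynomial τ R) + C (a l)) f')) :
    f - f' ∈ (Ideal.span (Set.range fun l : τ => (X l : MvPolynomial τ R) - C (a l))) ^ m := by
  rw [mem_pow_span_X_sub_C_iff]
  intro α hα
  rw [map_sub, coeff_sub, h α hα, sub_self]

/-- Polynomials congruent modulo `𝔪_a^m` have the same jet of order `< m` at `a`. [folklore] -/
theorem coeff_eq_of_sub_mem_pow_span_X_sub_C (a : τ → R) (m : ℕ) {f f' : MvPolynomial τ R}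
    (h : f - f' ∈ (Ideal.span (Set.range fun l : τ => (X l : MvPolynomial τ R) - C (a l))) ^ m)
    (α : τ →₀ ℕ) (hα : α.degree < m) :
    coeff α (aeval (fun l : τ => (X l : MvPolynomial τ R) + C (a l)) f) =
      coeff α (aeval (fun l : τ => (X l : MvPolynomial τ R) + C (a l)) f') := by
  rw [mem_pow_span_X_sub_C_iff] at h
  have := h α hα
  rwa [map_sub, coeff_sub, sub_eq_zero] at this

/-- The polynomial `Σ_{β ∈ S} v_β (X − a)^β` has jet `v` on `S` at `a`. [folklore] -/
theorem coeff_aeval_X_add_C_jetPoly [DecidableEq τ] (a : τ → R) (S : Finset (τ →₀ ℕ)) (v : (τ →₀ ℕ) → R)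
    {α : τ →₀ ℕ} (hα : α ∈ S) :
    coeff α (aeval (fun l : τ => (X l : MvPolynomial τ R) + C (a l))
      (aeval (fun l : τ => (X l : MvPolynomial τ R) - C (a l)) (∑ β ∈ S, monomial β (v β)))) = v α := by
  rw [aeval_X_add_C_aeval_X_sub_C, coeff_sum]
  simp only [coeff_monomial]
  rw [Finset.sum_ite_eq' S α v, if_pos hα]

end JetClass

section OnePointClass

variable {k : Type*} [CommRing k] {σ : Type*} [Finite σ] [DecidableEq σ] (i : σ)

/-- **Part 2 in quotient currency.** For `m ≤ d + 1` and a point `a` of the chart `i`, every class modulo `𝔪_a^m` is the class of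
`h(T_i := 1)` for some degree-`d` form `h`. [OURS · L1 W4.5b] -/
theorem exists_isHomogeneous_mk_dehomogenize_eq (a : {j : σ // j ≠ i} → k) {m d : ℕ} (hmd : m ≤ d + 1)
    (c : MvPolynomial {j : σ // j ≠ i} k ⧸
      (Ideal.span (Set.range fun j => (X j : MvPolynomial {j : σ // j ≠ i} k) - C (a j))) ^ m) :
    ∃ h : MvPolynomial σ k, h.IsHomogeneous d ∧ Ideal.Quotient.mk _ (dehomogenize i h) = c := by
  obtain ⟨q, rfl⟩ := Ideal.Quotient.mk_surjective c
  obtain ⟨h, hh, hjet⟩ := exists_isHomogeneous_forall_coeff_eq_onePoint i a hmd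
    (fun α => coeff α (aeval (fun j => (X j : MvPolynomial {j : σ // j ≠ i} k) + C (a j)) q))
  exact ⟨h, hh, Ideal.Quotient.eq.mpr (sub_mem_pow_span_X_sub_C_of_forall_coeff_eq a m hjet)⟩

end OnePointClass

/-! ## §2 Two points of a chart: prescribed class at one, zero at the other -/

section TwoPoints

variable {k : Type*} [Field k] {σ : Type*} [Finite σ] [DecidableEq σ] (i : σ)

/-- `x ≡ 1 (mod I)` ⇒ `x` is a unit modulo `I^m` (`x − 1` is nilpotent there). [folklore] -/
theorem isUnit_mk_pow_of_sub_one_mem {A : Type*} [CommRing A] (I : Ideal A) (m : ℕ) {x : A} (hx : x - 1 ∈ I) :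
    IsUnit (Ideal.Quotient.mk (I ^ m) x) := by
  have hn : IsNilpotent (Ideal.Quotient.mk (I ^ m) (x - 1)) :=
    ⟨m, by rw [← map_pow, Ideal.Quotient.eq_zero_iff_mem]; exact Ideal.pow_mem_pow hx m⟩
  simpa using hn.isUnit_add_one

/-- **Prescribed class at `a`, class zero at `b`.** `a ≠ b` points of the chart `i` (affine coordinates over a field), `m₁ + m₂ ≤ d + 1`:
for every class `c₁` modulo `𝔪_a^{m₁}` there is a degree-`d` form `g` with `g(T_i := 1) ≡ c₁ (mod 𝔪_a^{m₁})` and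
`g(T_i := 1) ∈ 𝔪_b^{m₂}` — `g = ℓ_b^{m₂} · h`, `ℓ_b = (a_j − b_j)⁻¹ (T_j − b_j T_i)` for a coordinate `j` separating the points.
[OURS · L1 W4.5b] -/
theorem exists_isHomogeneous_mk_eq_and_mk_eq_zero (a b : {j : σ // j ≠ i} → k) (hab : a ≠ b) {m₁ m₂ d : ℕ}
    (hd : m₁ + m₂ ≤ d + 1)
    (c₁ : MvPolynomial {j : σ // j ≠ i} k ⧸
      (Ideal.span (Set.range fun j => (X j : MvPolynomial {j : σ // j ≠ i} k) - C (a j))) ^ m₁) :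
    ∃ g : MvPolynomial σ k, g.IsHomogeneous d ∧
      Ideal.Quotient.mk ((Ideal.span (Set.range fun j => (X j : MvPolynomial {j : σ // j ≠ i} k) - C (a j))) ^ m₁)
          (dehomogenize i g) = c₁ ∧
        dehomogenize i g ∈ (Ideal.span (Set.range fun j => (X j : MvPolynomial {j : σ // j ≠ i} k) - C (b j))) ^ m₂ := by
  rcases Nat.eq_zero_or_pos m₁ with h0 | hpos
  · -- no condition at `a`
    subst h0
    haveI : Subsingleton (MvPolynomial {j : σ // j ≠ i} k ⧸
        (Ideal.span (Set.range fun j => (X j : MvPolynomial {j : σ // j ≠ i} k) - C (a j))) ^ 0) :=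
      Ideal.Quotient.subsingleton_iff.mpr (by rw [pow_zero, Ideal.one_eq_top])
    exact ⟨0, isHomogeneous_zero σ k d, Subsingleton.elim _ _, by rw [map_zero]; exact Submodule.zero_mem _⟩
  have hm₂d : m₂ ≤ d := by omega
  obtain ⟨j, hj⟩ := Function.ne_iff.mp hab
  have hc : (a j - b j)⁻¹ * (a j - b j) = 1 := inv_mul_cancel₀ (sub_ne_zero.mpr hj)
  -- the separating linear form and its dehomogenisation
  set ℓ : MvPolynomial σ k := C (a j - b j)⁻¹ * (X j.1 - C (b j) * X i) with hℓ
  set lam : MvPolynomial {j : σ // j ≠ i} k := C (a j - b j)⁻¹ * (X j - C (b j)) with hlam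
  have hℓhom : ℓ.IsHomogeneous 1 := by
    have h1 : ((X j.1 : MvPolynomial σ k) - C (b j) * X i).IsHomogeneous 1 :=
      (isHomogeneous_X k j.1).sub (by simpa using (isHomogeneous_C σ (b j)).mul (isHomogeneous_X k i))
    simpa using (isHomogeneous_C σ (a j - b j)⁻¹).mul h1
  have hℓlam : dehomogenize i ℓ = lam := by
    simp only [hℓ, hlam, map_mul, map_sub, algHom_C, MvPolynomial.algebraMap_eq, dehomogenize_X_self,
      dehomogenize_X_val, mul_one]
  have hlamb : lam ∈ Ideal.span (Set.range fun j => (X j : MvPolynomial {j : σ // j ≠ i} k) - C (b j)) :=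
    Ideal.mul_mem_left _ _ (Ideal.subset_span ⟨j, rfl⟩)
  have hlama : lam - 1 ∈ Ideal.span (Set.range fun j => (X j : MvPolynomial {j : σ // j ≠ i} k) - C (a j)) := by
    have hC : C (a j - b j)⁻¹ * (C (a j) - C (b j)) = (1 : MvPolynomial {j : σ // j ≠ i} k) := by
      rw [← map_sub, ← map_mul, hc, map_one]
    have : lam - 1 = C (a j - b j)⁻¹ * (X j - C (a j)) := by
      rw [hlam]; linear_combination hC
    rw [this]
    exact Ideal.mul_mem_left _ _ (Ideal.subset_span ⟨j, rfl⟩)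
  -- the unit and the corrected class
  obtain ⟨u, hu⟩ : IsUnit (Ideal.Quotient.mk
      ((Ideal.span (Set.range fun j => (X j : MvPolynomial {j : σ // j ≠ i} k) - C (a j))) ^ m₁) (lam ^ m₂)) := by
    rw [map_pow]; exact (isUnit_mk_pow_of_sub_one_mem _ m₁ hlama).pow m₂
  obtain ⟨h, hh, hhc⟩ := exists_isHomogeneous_mk_dehomogenize_eq i a (m := m₁) (d := d - m₂) (by omega)
    (↑u⁻¹ * c₁)
  refine ⟨ℓ ^ m₂ * h, ?_, ?_, ?_⟩
  · have := (hℓhom.pow m₂).mul hh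
    rwa [one_mul, Nat.add_sub_cancel' hm₂d] at this
  · rw [map_mul, map_pow, hℓlam, map_mul, hhc, ← hu, Units.mul_inv_cancel_left]
  · rw [map_mul, map_pow, hℓlam]
    exact Ideal.mul_mem_right _ _ (Ideal.pow_mem_pow hlamb m₂)

/-- **TWO FAT POINTS ARE NOT SUPERABUNDANT (in degree `d ≥ m₁ + m₂ − 1`), quotient currency.** `a ≠ b` points of the chart `i`
over a field, `m₁ + m₂ ≤ d + 1`: every pair of classes (mod `𝔪_a^{m₁}`, mod `𝔪_b^{m₂}`) is realised by `g(T_i := 1)` for ONE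
degree-`d` form `g`. [OURS · L1 W4.5b] -/
theorem exists_isHomogeneous_mk_dehomogenize_eq_twoPoints (a b : {j : σ // j ≠ i} → k) (hab : a ≠ b) {m₁ m₂ d : ℕ}
    (hd : m₁ + m₂ ≤ d + 1)
    (c₁ : MvPolynomial {j : σ // j ≠ i} k ⧸
      (Ideal.span (Set.range fun j => (X j : MvPolynomial {j : σ // j ≠ i} k) - C (a j))) ^ m₁)
    (c₂ : MvPolynomial {j : σ // j ≠ i} k ⧸
      (Ideal.span (Set.range fun j => (X j : MvPolynomial {j : σ // j ≠ i} k) - C (b j))) ^ m₂) :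
    ∃ g : MvPolynomial σ k, g.IsHomogeneous d ∧
      Ideal.Quotient.mk ((Ideal.span (Set.range fun j => (X j : MvPolynomial {j : σ // j ≠ i} k) - C (a j))) ^ m₁)
          (dehomogenize i g) = c₁ ∧
        Ideal.Quotient.mk ((Ideal.span (Set.range fun j => (X j : MvPolynomial {j : σ // j ≠ i} k) - C (b j))) ^ m₂)
          (dehomogenize i g) = c₂ := by
  obtain ⟨g₁, hg₁, h₁a, h₁b⟩ := exists_isHomogeneous_mk_eq_and_mk_eq_zero i a b hab hd c₁
  obtain ⟨g₂, hg₂, h₂b, h₂a⟩ := exists_isHomogeneous_mk_eq_and_mk_eq_zero i b a hab.symm (m₁ := m₂) (m₂ := m₁) (d := d)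
    (by omega) c₂
  refine ⟨g₁ + g₂, hg₁.add hg₂, ?_, ?_⟩
  · rw [map_add, map_add, h₁a, Ideal.Quotient.eq_zero_iff_mem.mpr h₂a, add_zero]
  · rw [map_add, map_add, h₂b, Ideal.Quotient.eq_zero_iff_mem.mpr h₁b, zero_add]

/-! ## §3 Jet currency and the two-point lift -/

/-- **TWO FAT POINTS ARE NOT SUPERABUNDANT, jet currency** (= part 1's `hind` for a two-point cluster on one chart): `a ≠ b`,
`m₁ + m₂ ≤ d + 1` ⇒ every pair of jets (order `< m₁` at `a`, order `< m₂` at `b`) is the pair of jets of ONE degree-`d` form.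
[OURS · L1 W4.5b] -/
theorem exists_isHomogeneous_forall_coeff_eq_twoPoints (a b : {j : σ // j ≠ i} → k) (hab : a ≠ b) {m₁ m₂ d : ℕ}
    (hd : m₁ + m₂ ≤ d + 1) (v₁ v₂ : ({j : σ // j ≠ i} →₀ ℕ) → k) :
    ∃ g : MvPolynomial σ k, g.IsHomogeneous d ∧
      (∀ α : {j : σ // j ≠ i} →₀ ℕ, α.degree < m₁ →
        coeff α (aeval (fun j => (X j : MvPolynomial {j : σ // j ≠ i} k) + C (a j)) (dehomogenize i g)) = v₁ α) ∧
      (∀ α : {j : σ // j ≠ i} →₀ ℕ, α.degree < m₂ →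
        coeff α (aeval (fun j => (X j : MvPolynomial {j : σ // j ≠ i} k) + C (b j)) (dehomogenize i g)) = v₂ α) := by
  classical
  haveI : Fintype {α : {j : σ // j ≠ i} →₀ ℕ // α.degree < m₁} := @Fintype.ofFinite _ (finite_subtype_degree_lt m₁)
  haveI : Fintype {α : {j : σ // j ≠ i} →₀ ℕ // α.degree < m₂} := @Fintype.ofFinite _ (finite_subtype_degree_lt m₂)
  let S₁ : Finset ({j : σ // j ≠ i} →₀ ℕ) :=
    Finset.univ.map (Function.Embedding.subtype fun α : {j : σ // j ≠ i} →₀ ℕ => α.degree < m₁)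
  let S₂ : Finset ({j : σ // j ≠ i} →₀ ℕ) :=
    Finset.univ.map (Function.Embedding.subtype fun α : {j : σ // j ≠ i} →₀ ℕ => α.degree < m₂)
  have hS₁ : ∀ α : {j : σ // j ≠ i} →₀ ℕ, α.degree < m₁ → α ∈ S₁ := fun α hα => by
    simp only [S₁, Finset.mem_map, Finset.mem_univ, Function.Embedding.coe_subtype, true_and, Subtype.exists,
      exists_prop, exists_eq_right]; exact hα
  have hS₂ : ∀ α : {j : σ // j ≠ i} →₀ ℕ, α.degree < m₂ → α ∈ S₂ := fun α hα => by
    simp only [S₂, Finset.mem_map, Finset.mem_univ, Function.Embedding.coe_subtype, true_and, Subtype.exists,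
      exists_prop, exists_eq_right]; exact hα
  let J₁ : MvPolynomial {j : σ // j ≠ i} k :=
    aeval (fun l => (X l : MvPolynomial {j : σ // j ≠ i} k) - C (a l)) (∑ β ∈ S₁, monomial β (v₁ β))
  let J₂ : MvPolynomial {j : σ // j ≠ i} k :=
    aeval (fun l => (X l : MvPolynomial {j : σ // j ≠ i} k) - C (b l)) (∑ β ∈ S₂, monomial β (v₂ β))
  obtain ⟨g, hg, h₁, h₂⟩ := exists_isHomogeneous_mk_dehomogenize_eq_twoPoints i a b hab hd
    (Ideal.Quotient.mk _ J₁) (Ideal.Quotient.mk _ J₂)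
  refine ⟨g, hg, fun α hα => ?_, fun α hα => ?_⟩
  · rw [coeff_eq_of_sub_mem_pow_span_X_sub_C a m₁ (Ideal.Quotient.eq.mp h₁) α hα]
    exact coeff_aeval_X_add_C_jetPoly a S₁ v₁ (hS₁ α hα)
  · rw [coeff_eq_of_sub_mem_pow_span_X_sub_C b m₂ (Ideal.Quotient.eq.mp h₂) α hα]
    exact coeff_aeval_X_add_C_jetPoly b S₂ v₂ (hS₂ α hα)

end TwoPoints

section TwoPointLift

variable {O k : Type*} [CommRing O] [Field k] (π : O →+* k) {σ : Type*} [Finite σ] [DecidableEq σ]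

/-- **THE TWO-POINT LIFT ALONG ANY TWO SECTIONS.** `π : O ↠ k` onto a field, `ker π ≤ jacobson ⊥` (e.g. `O` local); `a, b` affine
coordinates of two `O`-points (sections) on the chart `i` with DISTINCT reductions; `m₁ + m₂ ≤ d + 1`; `g ∈ k[T_σ]` a form of degree `d`
of order `≥ m₁` at `ā` and `≥ m₂` at `b̄`. THEN there is a form `G ∈ O[T_σ]_d` with `map π G = g`, `G(T_i := 1) ∈ 𝔪_a^{m₁}` and
`G(T_i := 1) ∈ 𝔪_b^{m₂}`: order `≥ m₁` along the section `a` and `≥ m₂` along the section `b` — no incidence condition.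
(Part 1 headline, `ι = Fin 2`, with `exists_isHomogeneous_forall_coeff_eq_twoPoints`.) [OURS · L1 W4.5b] -/
theorem exists_isHomogeneous_lift_dehomogenize_mem_pow_twoPoints (hπ : Function.Surjective π)
    (hker : RingHom.ker π ≤ (⊥ : Ideal O).jacobson) {d m₁ m₂ : ℕ} (hd : m₁ + m₂ ≤ d + 1) (i : σ)
    (a b : {j : σ // j ≠ i} → O) (hab : (fun j => π (a j)) ≠ fun j => π (b j))
    (g : MvPolynomial σ k) (hg : g.IsHomogeneous d)
    (hga : dehomogenize i g ∈
      (Ideal.span (Set.range fun j => (X j : MvPolynomial {j : σ // j ≠ i} k) - C (π (a j)))) ^ m₁)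
    (hgb : dehomogenize i g ∈
      (Ideal.span (Set.range fun j => (X j : MvPolynomial {j : σ // j ≠ i} k) - C (π (b j)))) ^ m₂) :
    ∃ G : MvPolynomial σ O, G.IsHomogeneous d ∧ MvPolynomial.map π G = g ∧
      dehomogenize i G ∈ (Ideal.span (Set.range fun j => (X j : MvPolynomial {j : σ // j ≠ i} O) - C (a j))) ^ m₁ ∧
      dehomogenize i G ∈ (Ideal.span (Set.range fun j => (X j : MvPolynomial {j : σ // j ≠ i} O) - C (b j))) ^ m₂ := by
  obtain ⟨G, hG, hGg, hGZ⟩ := exists_isHomogeneous_lift_forall_dehomogenize_mem_pow π hπ hker (ι := Fin 2)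
    (fun _ => i) (fun t => ![a, b] t) (fun t => ![m₁, m₂] t)
    (fun v => by
      obtain ⟨g₁, hg₁, h₁, h₂⟩ :=
        exists_isHomogeneous_forall_coeff_eq_twoPoints i (fun j => π (a j)) (fun j => π (b j)) hab hd (v 0) (v 1)
      refine ⟨g₁, hg₁, fun t α hα => ?_⟩
      fin_cases t
      · exact h₁ α (by simpa using hα)
      · exact h₂ α (by simpa using hα))
    g hg (fun t => by fin_cases t <;> simpa)
  exact ⟨G, hG, hGg, by simpa using hGZ 0, by simpa using hGZ 1⟩

end TwoPointLift

end Summit.ResolutionOfSingularities.ResolutionOfSingularities.Theorems.EquisingularLiftNat.ClusterLift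

end
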